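import Literature.MathematicalPhysics.KineticTheory.SiteChainLangevinKernel
import HarnessLib

/-!
# The Langevin semigroup of the cell chains

Topic `Literature/MathematicalPhysics/KineticTheory`, grouping namespace `…KineticTheory.HeatConduction`.
The CELL CHAINS `cellChain ω₂ lam β γ c` of `CellChain.lean` (the `ω₂`-pinned unit-coupling harmonic
host between Langevin baths `γ`, with the quartic pinning `lam q⁴/4` and the FPU-β bond `β r⁴/4`
switched on exactly at the cells `c i = true`; Bonetto–Lebowitz–Rey-Bellet 2000 §3 eq. (8), §10 item 1)
are uniformly confining site chains (`SiteChain.UniformlyConfining`, `SiteChainConfined.lean`) when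
`ω₂ > 0` and `lam, β, γ ≥ 0`, so the model-free pipeline gives them transition kernels, Dynkin's
identity and a Feller Markov semigroup with generator `(cellChain ω₂ lam β γ c).generator N T_L T_R` on
`C_c^∞` (`N ≥ 1`, `T_L, T_R ≥ 0`):

* `cellChain_deriv_U_eq`, `cellChain_abs_deriv_U_le`, `cellChain_abs_deriv_V_le`, `cellChain_tendsto_U`;
* `cellChain_uniformlyConfining` — the instance (constants `A = ω₂ + lam + 3`, `B = 3 + β`, uniform in
  the cell indicator `c` and in the site);
* `cellChain_exists_fellerSemigroup` — existence, packaged over the generic interface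
  `MarkovSemigroupFor` of `ReyBelletThomas2002.lean`, of a Feller Markov semigroup with Dynkin's
  identity whose kernels ARE `(cellChain ω₂ lam β γ c).langevinKernel N T_L T_R` (the form in which the
  summit-side steady-state arguments — Krylov–Bogoliubov from an energy bound, Fokker–Planck
  identification — consume it).

## References

* F. Bonetto, J. L. Lebowitz, L. Rey-Bellet, *Fourier's law: a challenge to theorists* (2000), §3
  eq. (8), §4.1 eq. (10), §10 item 1.
* N. Cuneo, J.-P. Eckmann, M. Hairer, L. Rey-Bellet, Electron. J. Probab. **23** (2018) no. 55,
  eq. (2.2)–(2.3), §3 eq. (3.2).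

## Design choices

* Everything is stated for an ARBITRARY cell indicator `c : ℕ → Bool` (prefix rungs `· < k`, periodic
  cells `cellPeriodic ℓ`, single impurities `· = x` are all instances).
* NOT here: any energy / Lyapunov bound along the semigroup (the existence of steady states of the
  mixed-degree chains is open mathematics, cf. CEHRB 2018 Rem. 2.11), uniqueness, response.
-/

noncomputable section

open MeasureTheory ProbabilityTheory Filter Topology Set Metric
open scoped NNReal ENNReal ContDiff

namespace Literature.MathematicalPhysics.KineticTheory.HeatConduction

open Literature.Probability.Process Literature.MathematicalPhysics.KineticTheory

variable {N : ℕ}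

section CellChain

/-- `U_i'(q) = ω₂ q + λ_i q³` with `λ_i = [c i] lam`. [folklore] -/
theorem cellChain_deriv_U_eq (ω₂ lam β γ : ℝ) (c : ℕ → Bool) (i : ℕ) (q : ℝ) :
    deriv ((cellChain ω₂ lam β γ c).U i) q = ω₂ * q + (if c i then lam else 0) * q ^ 3 := by
  rw [cellChain_U, pinnedChain_deriv_U]

/-- `V_i'(r) = r + β_i r³` with `β_i = [c i] β`. [folklore] -/
theorem cellChain_deriv_V_eq (ω₂ lam β γ : ℝ) (c : ℕ → Bool) (i : ℕ) (r : ℝ) :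
    deriv ((cellChain ω₂ lam β γ c).V i) r = r + (if c i then β else 0) * r ^ 3 := by
  rw [cellChain_V, pinnedChain_deriv_V]

/-- The switched amplitude `[b] a` lies in `[0, a]` for `a ≥ 0`. [folklore] -/
theorem ite_amplitude_mem_Icc {a : ℝ} (ha : 0 ≤ a) (b : Bool) : (if b then a else 0 : ℝ) ∈ Set.Icc 0 a := by
  cases b <;> simp [ha]

/-- **The pinning force is dominated by the pinning energy, uniformly in the cell indicator**:
`|ω₂ q + λ_i q³| ≤ (ω₂ + lam + 3)(1 + U_i(q))` (`ω₂ > 0`, `lam ≥ 0`). [folklore] -/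
theorem cellChain_abs_deriv_U_le {ω₂ lam : ℝ} (hω : 0 < ω₂) (hl : 0 ≤ lam) (β γ : ℝ) (c : ℕ → Bool) (i : ℕ)
    (q : ℝ) :
    |deriv ((cellChain ω₂ lam β γ c).U i) q| ≤ (ω₂ + lam + 3) * (1 + (cellChain ω₂ lam β γ c).U i q) := by
  rw [cellChain_deriv_U_eq]
  show |ω₂ * q + (if c i then lam else 0) * q ^ 3| ≤
    (ω₂ + lam + 3) * (1 + (ω₂ * q ^ 2 / 2 + (if c i then lam else 0) * q ^ 4 / 4))
  obtain ⟨hl0, hl1⟩ := ite_amplitude_mem_Icc hl (c i)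
  set l := (if c i then lam else 0 : ℝ) with hldef
  have h2 := abs_le_half_add_sq_half q
  have h3 := abs_pow_three_le q
  have hq2 : 0 ≤ q ^ 2 := sq_nonneg q
  have hq4 : 0 ≤ q ^ 4 := by positivity
  have hsq : q ^ 2 ≤ (1 + q ^ 4) / 2 := by nlinarith [sq_nonneg (q ^ 2 - 1)]
  calc |ω₂ * q + l * q ^ 3| ≤ |ω₂ * q| + |l * q ^ 3| := abs_add_le _ _
    _ = ω₂ * |q| + l * |q| ^ 3 := by rw [abs_mul, abs_mul, abs_of_pos hω, abs_of_nonneg hl0, abs_pow]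
    _ ≤ ω₂ * (1 / 2 + q ^ 2 / 2) + l * ((q ^ 2 + q ^ 4) / 2) :=
        add_le_add (mul_le_mul_of_nonneg_left h2 hω.le) (mul_le_mul_of_nonneg_left h3 hl0)
    _ ≤ (ω₂ + lam + 3) * (1 + (ω₂ * q ^ 2 / 2 + l * q ^ 4 / 4)) := by
        nlinarith [mul_nonneg hω.le hq2, mul_nonneg hl0 hq4, mul_nonneg hl0 hq2,
          mul_le_mul_of_nonneg_left hsq hl0, mul_nonneg (mul_nonneg hω.le hq2) hl,
          mul_nonneg (mul_nonneg hl0 hq4) hω.le, mul_nonneg (mul_nonneg hl0 hq4) hl,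
          mul_nonneg (sub_nonneg.2 hl1) hq4]

/-- **The bond force is dominated by the bond energy, uniformly in the cell indicator**:
`|r + β_i r³| ≤ (3 + β)(1 + V_i(r))` (`β ≥ 0`). [folklore] -/
theorem cellChain_abs_deriv_V_le {β : ℝ} (hβ : 0 ≤ β) (ω₂ lam γ : ℝ) (c : ℕ → Bool) (i : ℕ) (r : ℝ) :
    |deriv ((cellChain ω₂ lam β γ c).V i) r| ≤ (3 + β) * (1 + (cellChain ω₂ lam β γ c).V i r) := by
  rw [cellChain_deriv_V_eq]
  show |r + (if c i then β else 0) * r ^ 3| ≤ (3 + β) * (1 + (r ^ 2 / 2 + (if c i then β else 0) * r ^ 4 / 4))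
  obtain ⟨hb0, hb1⟩ := ite_amplitude_mem_Icc hβ (c i)
  have h := abs_deriv_V_le hb0 (le_refl (r ^ 2 / 2 + (if c i then β else 0) * r ^ 4 / 4))
  have hV0 : 0 ≤ 1 + (r ^ 2 / 2 + (if c i then β else 0) * r ^ 4 / 4) := by positivity
  exact h.trans (mul_le_mul_of_nonneg_right (by linarith) hV0)

/-- Every pinning potential of a cell chain grows at infinity: `U_i(q) ≥ ω₂ q²/2 → ∞` (`ω₂ > 0`,
`lam ≥ 0`). [folklore] -/
theorem cellChain_tendsto_U {ω₂ lam : ℝ} (hω : 0 < ω₂) (hl : 0 ≤ lam) (β γ : ℝ) (c : ℕ → Bool) (i : ℕ) :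
    Tendsto ((cellChain ω₂ lam β γ c).U i) (cocompact ℝ) atTop := by
  obtain ⟨hl0, -⟩ := ite_amplitude_mem_Icc hl (c i)
  have hlow : ∀ q : ℝ, ‖q‖ ^ 2 * (ω₂ / 2) ≤ (cellChain ω₂ lam β γ c).U i q := fun q => by
    show ‖q‖ ^ 2 * (ω₂ / 2) ≤ ω₂ * q ^ 2 / 2 + (if c i then lam else 0) * q ^ 4 / 4
    rw [Real.norm_eq_abs, sq_abs]
    nlinarith [mul_nonneg hl0 (by positivity : (0:ℝ) ≤ q ^ 4)]
  refine tendsto_atTop_mono hlow ?_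
  exact ((tendsto_pow_atTop (by norm_num : (2:ℕ) ≠ 0)).comp tendsto_norm_cocompact_atTop).atTop_mul_const
    (by positivity)

/-- **Cell chains are uniformly confining** (`ω₂ > 0`, `lam, β, γ ≥ 0`): `U_i, V_i` smooth and
nonnegative, `|U_i'| ≤ (ω₂ + lam + 3)(1 + U_i)`, `|V_i'| ≤ (3 + β)(1 + V_i)` uniformly in the site and in
the cell indicator, `U_i → ∞`. [folklore] -/
theorem cellChain_uniformlyConfining {ω₂ lam β γ : ℝ} (hω : 0 < ω₂) (hl : 0 ≤ lam) (hβ : 0 ≤ β) (hγ : 0 ≤ γ)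
    (c : ℕ → Bool) : (cellChain ω₂ lam β γ c).UniformlyConfining where
  contDiff_U := fun i => by rw [cellChain_U]; exact pinnedChain_contDiff_U _ _ _ _
  contDiff_V := fun i => by rw [cellChain_V]; exact pinnedChain_contDiff_V _ _ _ _
  γ_nonneg := hγ
  U_nonneg := fun i q => by
    obtain ⟨hl0, -⟩ := ite_amplitude_mem_Icc hl (c i)
    show 0 ≤ ω₂ * q ^ 2 / 2 + (if c i then lam else 0) * q ^ 4 / 4
    positivity
  V_nonneg := fun i r => by
    obtain ⟨hb0, -⟩ := ite_amplitude_mem_Icc hβ (c i)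
    show 0 ≤ r ^ 2 / 2 + (if c i then β else 0) * r ^ 4 / 4
    positivity
  exists_abs_deriv_U_le := ⟨ω₂ + lam + 3, by positivity, fun i q => cellChain_abs_deriv_U_le hω hl β γ c i q⟩
  exists_abs_deriv_V_le := ⟨3 + β, by positivity, fun i r => cellChain_abs_deriv_V_le hβ ω₂ lam γ c i r⟩
  tendsto_U := fun i => cellChain_tendsto_U hω hl β γ c i

/-- **The Feller Markov semigroup of a cell chain.** For `ω₂ > 0`, `lam, β, γ ≥ 0`, every cell
indicator `c`, `N ≥ 1` and `T_L, T_R ≥ 0` there is a measurable Markov semigroup on phase space with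
Dynkin's identity for the generator `(cellChain ω₂ lam β γ c).generator N T_L T_R` on `C_c^∞`
(`MarkovSemigroupFor`) which is Feller and whose kernels are the Langevin kernels
`(cellChain ω₂ lam β γ c).langevinKernel N T_L T_R` of the SDE pipeline (`UniformlyConfining.semigroup`).
[cite: CuneoEckmannHairerReyBellet2018, eq. (2.3)] -/
theorem cellChain_exists_fellerSemigroup {ω₂ lam β γ : ℝ} (hω : 0 < ω₂) (hl : 0 ≤ lam) (hβ : 0 ≤ β)
    (hγ : 0 ≤ γ) (c : ℕ → Bool) (hN : 0 < N) {T_L T_R : ℝ} (hL : 0 ≤ T_L) (hR : 0 ≤ T_R) :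
    ∃ S : MarkovSemigroupFor ((cellChain ω₂ lam β γ c).generator N T_L T_R),
      (∀ (t : ℝ≥0) (g : BoundedContinuousFunction (PhaseSpace N) ℝ),
          Continuous fun x => ∫ y, g y ∂(S.kernel t x)) ∧
      ∀ t : ℝ≥0, S.kernel t = (cellChain ω₂ lam β γ c).langevinKernel N T_L T_R t :=
  ⟨(cellChain_uniformlyConfining hω hl hβ hγ c).semigroup N T_L T_R hN hL hR,
    fun t g => (cellChain_uniformlyConfining hω hl hβ hγ c).continuous_integral_langevinKernel_bcf N T_L T_R t g,
    fun _ => rfl⟩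

end CellChain

end Literature.MathematicalPhysics.KineticTheory.HeatConduction
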